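import Summits.QuantumFields.BalabanUV.Beta.GAN24.FibreKernelControlBounds
import Summits.QuantumFields.BalabanUV.Beta.GAN24.FibreKernelControlAlias

/-!
# `BalabanUV.Beta.GAN24.FibreKernelControlAliasBound` — binder row G-an2-4 / (CONV-C), road P1-fibre, self-row **N15k-ker*** PART 4:
# THE ASSEMBLED KERNEL CONTROL OF THE ALIAS FIBRE `fibreAl N (ofRealVec q)`, `q ∈ BZ∖{0}`, WITH DISPLAYED CONSTANTS

NOT IN PRINT; OUR PROOF ATTEMPT.  HONEST FRAMING (cell contract, verbatim): «discharging `BetaPertH` makes Bałaban's UV stability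
UNCONDITIONAL — a real constructive-QFT result; it is NOT the continuum limit and NOT the Clay problem.»  HONEST DEPENDENCY (verbatim):
«continuum YM on T⁴ ⇐ BetaPertH ∧ nine spine estimates (0/9 proved); BetaPertH ⇐ (D1) ∧ (D4) ∧ CAP+tail; G-an2-4 gates asym, D1 and
NE2/3/4.»  [folklore] real-arithmetic assembly of PART 2 (`FibreKernelControlBounds.sum_normSq_le_energy_sq`, `norm_c_sq_mul_sum_le`) with the
constants of PART 3 (`FibreKernelControlAlias`); two explicit-constant `def`s (`kcOf`, `kAOf`: closed-form polynomials in `|q|²` with coefficients in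
`π` and `aliasWtConst D` — NOT numerics, no engine value, ref2 c3); no cited fact, no wall binder, no `def … : Prop`, no unit sequence touched.
NOT summit progress; discharges nothing of the K-slot `GAN24.CombesThomas.ConvCK 3 Lc`.

## What is proved (`N ≥ 1`, `q ∈ [−π, π]^D ∖ {0}`, `F = fibreAl N (ofRealVec q) h`, `(A, c) ∈ ker B`: `GRows F 0 A c ∧ QRows F 0 A`, `E = energy F A`)
* **`norm_c_sq_le_fibre`**: `‖c‖² ≤ K_c(D, |q|²)/N⁴ · E`, `K_c(D, s) = 2D(π²s²/8 + W s³/2)/(4/π²)^{2D+1}` (`kcOf`; from (o1) summed: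
  `Σ_κ Σ_m‖wQ‖²/ℓ ≤ D·2N^D·N^{D+4}(π²/(8s) + W/2)` and `Σ_κ‖capV_κ‖² ≥ ((4/π²)^D N^{D+4}/s²)²·(4/π²)s`);
* **`sum_normSq_le_fibre`**: `Σ_m Σ_κ ‖A_{mκ}‖² ≤ K_A(D, |q|²)·N²·E`, `K_A(D, s) = 2D(W + K_c s W²/16)/(4/π²)^{D+1} + 1/4 + K_c W/16` (`kAOf`;
  = PART 2's squared-currency bound at `λ = 4/N²`, `β2 = (4/π²)^{D+1}N^{2D+2}`, `aO = N^{2D+4}W`, `bO2 = s(N^{D+4}W/4)²`, `gO = N⁶W/16`, `Cc2 = K_c/N⁴`);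
* `q`-UNIFORM forms on the zone (`|q|² ≤ Dπ²`, monotonicity `kcOf_mono`/`kAOf_mono`): **`sum_normSq_le_fibre_unif`** (`≤ K_A(D, Dπ²)·N²·E`) and
  **`norm_c_sq_le_fibre_unif`** (`≤ K_c(D, Dπ²)/N⁴·E`).
READING (for the L10 owner; nothing of it asserted here): with `2E = re⟪Â, H Â⟫` (PART 1 `two_mul_energy_eq_form`) these say that in the Euclidean
weighting `(Â_m/N for all m, N²·c)` — or the finer `(Â_0/N, √L_m Â_m (m ≠ 0), N²c)` via PART 2's separate (o3)/(o4) — the kernel coercivity constant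
of the real KKT fibre is `≥ 1/(2K_A)` resp. `O(1)`, uniformly in `N ≥ 1` and `q ∈ BZ∖{0}` (`q = 0`: the `Fibre0` packaging of leaf-15, not treated here);
`‖H‖ ≤ 2·max_m N²L_m·N⁻² ≤ 8D` in the same weighting.  These are the (hcoer)/(hH) numbers N15k asks for; the LBB numbers (hB)/(hC) are NOT in this file.
Unit `b2b-balaban-gan24-formalise-leaf-10` (G-an2-4 formalisation swarm), 2026-08-20.
-/

noncomputable section

open Complex Finset
open scoped BigOperators Real ComplexConjugate
open Literature.Probability.LatticeModels (TorusSite)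
open Literature.MathematicalPhysics.QuantumFieldTheory.Balaban1983to89.B4Strip (ofRealVec)
open Literature.MathematicalPhysics.QuantumFieldTheory.King1986 (momSq momSq_nonneg)

namespace Summit.QuantumFields.BalabanUV.Beta.GAN24.FibreKernelControlAliasBound

open FibreSymbols (dhat dflat lapSym)
open FibreBlockSolve (dot)
open CapacitanceSolve (Fibre GRows QRows capV)
open AliasWeights AliasWeightsSum CapacitanceScalarBounds CapacitanceScalarBoundsBorder
open AliasObjects (LAl fibreAl)
open FibreKernelControl FibreKernelControlBounds FibreKernelControlAlias

variable {D : ℕ} {N : ℕ} [NeZero N]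

/-! ## §1 The gauge constant: `‖c‖² ≤ K_c(D, |q|²)·E/N⁴` -/

/-- The displayed constant of the gauge-constant bound: `K_c(D, s) = 2D·(π²s²/8 + aliasWtConst D·s³/2)/(4/π²)^{2D+1}` (`s = |q|²`). -/
def kcOf (D : ℕ) (s : ℝ) : ℝ := 2 * D * (π ^ 2 * s ^ 2 / 8 + aliasWtConst D * s ^ 3 / 2) / (4 / π ^ 2) ^ (2 * D + 1)

/-- [folklore] `0 ≤ K_c(D, s)` for `s ≥ 0`. -/
theorem kcOf_nonneg (D : ℕ) {s : ℝ} (hs : 0 ≤ s) : 0 ≤ kcOf D s := by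
  unfold kcOf
  have hW := CapacitanceEndpointBlocks.aliasWtConst_nonneg D
  positivity

/-- [folklore] `K_c(D, ·)` is monotone on `[0, ∞)`. -/
theorem kcOf_mono (D : ℕ) {s t : ℝ} (hs : 0 ≤ s) (hst : s ≤ t) : kcOf D s ≤ kcOf D t := by
  unfold kcOf
  have hW := CapacitanceEndpointBlocks.aliasWtConst_nonneg D
  gcongr

/-- [folklore] **(o1) FOR THE ALIAS FIBRE — THE GAUGE CONSTANT GAINS `|q|²`**: on `ker B` of `fibreAl N (ofRealVec q)`, `q ∈ BZ∖{0}`, `N ≥ 1`,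
`‖c‖² ≤ K_c(D, |q|²)/N⁴ · E(A)`. -/
theorem norm_c_sq_le_fibre (hN : 1 ≤ N) (q : Fin D → ℝ) (hq : ∀ i, |q i| ≤ π) (hq0 : q ≠ 0) (h : ∀ m, LAl N (ofRealVec q) m ≠ 0)
    {A : TorusSite D N → Fin D → ℂ} {c : ℂ} (hG : GRows (fibreAl N (ofRealVec q) h) 0 A c) (hQ : QRows (fibreAl N (ofRealVec q) h) 0 A) :
    ‖c‖ ^ 2 ≤ kcOf D (momSq q) / (N : ℝ) ^ 4 * energy (fibreAl N (ofRealVec q) h) A := by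
  classical
  set F := fibreAl N (ofRealVec q) h with hF
  set E := energy F A with hE
  set s := momSq q with hs
  have hN0 : (0 : ℝ) < N := by exact_mod_cast hN
  have hs0 : 0 < s := momSq_pos hq0
  have hπ : (0 : ℝ) < π := Real.pi_pos
  have hE0 : 0 ≤ E := energy_nonneg F A
  set V₀ := ((4 / π ^ 2) ^ D * (N : ℝ) ^ (D + 4) / s ^ 2) ^ 2 * (4 / π ^ 2 * s) with hV₀
  set U₁ := (D : ℝ) * (2 * (N : ℝ) ^ D * ((N : ℝ) ^ (D + 4) * (π ^ 2 / (8 * s) + aliasWtConst D / 2))) with hU₁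
  have hV0 : 0 < V₀ := by positivity
  have hmain := norm_c_sq_mul_sum_le F (realZone q h) hG hQ
  have hV : V₀ ≤ ∑ κ, ‖capV F κ‖ ^ 2 := sum_norm_capV_sq_ge hN q hq hq0 h
  have hU : ∑ κ, ∑ m, ‖F.wQ m κ‖ ^ 2 / blkLap (F.dd m) ≤ U₁ := by
    calc ∑ κ, ∑ m, ‖F.wQ m κ‖ ^ 2 / blkLap (F.dd m)
        ≤ ∑ _κ : Fin D, 2 * (N : ℝ) ^ D * ((N : ℝ) ^ (D + 4) * (π ^ 2 / (8 * s) + aliasWtConst D / 2)) :=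
          Finset.sum_le_sum fun κ _ => aFull_le hN q hq hq0 h κ
      _ = U₁ := by rw [Finset.sum_const, Finset.card_univ, Fintype.card_fin, nsmul_eq_mul]
  have h1 : ‖c‖ ^ 2 * V₀ ≤ U₁ * E :=
    calc ‖c‖ ^ 2 * V₀ ≤ ‖c‖ ^ 2 * ∑ κ, ‖capV F κ‖ ^ 2 := mul_le_mul_of_nonneg_left hV (sq_nonneg _)
      _ ≤ (∑ κ, ∑ m, ‖F.wQ m κ‖ ^ 2 / blkLap (F.dd m)) * E := hmain
      _ ≤ U₁ * E := mul_le_mul_of_nonneg_right hU hE0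
  have h2 : ‖c‖ ^ 2 ≤ U₁ * E / V₀ := by rw [le_div_iff₀ hV0]; exact h1
  have hπ0 : π ≠ 0 := hπ.ne'
  have hN1 : (N : ℝ) ≠ 0 := hN0.ne'
  have hs1 : s ≠ 0 := hs0.ne'
  calc ‖c‖ ^ 2 ≤ U₁ * E / V₀ := h2
    _ = kcOf D s / (N : ℝ) ^ 4 * E := by
        rw [hU₁, hV₀]
        unfold kcOf
        simp only [div_pow]
        field_simp
        ring

/-! ## §2 The assembled fibre bound: `Σ_m Σ_κ ‖A_{mκ}‖² ≤ K_A(D, |q|²)·N²·E(A)` -/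

/-- The displayed constant of the mass bound:
`K_A(D, s) = 2D·(W + K_c(D,s)·s·W²/16)/(4/π²)^{D+1} + 1/4 + K_c(D,s)·W/16`, `W = aliasWtConst D`. -/
def kAOf (D : ℕ) (s : ℝ) : ℝ :=
  2 * D * (aliasWtConst D + kcOf D s * s * aliasWtConst D ^ 2 / 16) / (4 / π ^ 2) ^ (D + 1) + 1 / 4 + kcOf D s * aliasWtConst D / 16

/-- [folklore] `K_A(D, ·)` is monotone on `[0, ∞)`. -/
theorem kAOf_mono (D : ℕ) {s t : ℝ} (hs : 0 ≤ s) (hst : s ≤ t) : kAOf D s ≤ kAOf D t := by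
  unfold kAOf
  have hW := CapacitanceEndpointBlocks.aliasWtConst_nonneg D
  have hk := kcOf_nonneg D hs
  have hkt := kcOf_nonneg D (hs.trans hst)
  have hm := kcOf_mono D hs hst
  gcongr

/-- [folklore] **KERNEL CONTROL OF THE ALIAS FIBRE (N15k, fibre half), FINE UNITS.**  For `N ≥ 1`, `q ∈ [−π, π]^D ∖ {0}`, `p = ofRealVec q`,
and any `(A, c)` in the kernel of the constraint rows of the alias fibre (`GRows F 0 A c`, `QRows F 0 A`, `F = fibreAl N p h`):
`Σ_m Σ_κ ‖A_{mκ}‖² ≤ K_A(D, |q|²) · N² · E(A)` — the total fine mass is `O(N²)` times the transverse energy, UNIFORMLY in `N`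
and in `q` (constants displayed: `kAOf`, `kcOf`, `aliasWtConst`). -/
theorem sum_normSq_le_fibre (hN : 1 ≤ N) (q : Fin D → ℝ) (hq : ∀ i, |q i| ≤ π) (hq0 : q ≠ 0) (h : ∀ m, LAl N (ofRealVec q) m ≠ 0)
    {A : TorusSite D N → Fin D → ℂ} {c : ℂ} (hG : GRows (fibreAl N (ofRealVec q) h) 0 A c) (hQ : QRows (fibreAl N (ofRealVec q) h) 0 A) :
    ∑ m, ∑ κ, ‖A m κ‖ ^ 2 ≤ kAOf D (momSq q) * (N : ℝ) ^ 2 * energy (fibreAl N (ofRealVec q) h) A := by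
  classical
  set F := fibreAl N (ofRealVec q) h with hF
  set s := momSq q with hs
  have hN0 : (0 : ℝ) < N := by exact_mod_cast hN
  have hs0 : 0 < s := momSq_pos hq0
  have hπ : (0 : ℝ) < π := Real.pi_pos
  have hW := CapacitanceEndpointBlocks.aliasWtConst_nonneg D
  have hkc := kcOf_nonneg D hs0.le
  have key := sum_normSq_le_energy_sq F (realZone q h) hG hQ 0
    (lam := 4 / (N : ℝ) ^ 2) (β2 := (4 / π ^ 2) ^ (D + 1) * (N : ℝ) ^ (2 * D + 2))
    (aO := (N : ℝ) ^ (2 * D + 4) * aliasWtConst D) (bO2 := s * ((N : ℝ) ^ (D + 4) / 4 * aliasWtConst D) ^ 2)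
    (gO := (N : ℝ) ^ 6 / 16 * aliasWtConst D) (Cc2 := kcOf D s / (N : ℝ) ^ 4)
    (by positivity) (fun m hm => lam_le q hq h m hm) (by positivity) (fun κ => beta_sq_le hN q hq h κ)
    (fun κ => aOff_le hN q hq h κ) (fun κ => bOff_sq_le hN q hq h κ) (gOff_le hN q hq h) (by positivity)
    (norm_c_sq_le_fibre hN q hq hq0 h hG hQ)
  refine key.trans (le_of_eq ?_)
  congr 1
  have hπ0 : π ≠ 0 := hπ.ne'
  have hN1 : (N : ℝ) ≠ 0 := hN0.ne'
  unfold kAOf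
  simp only [div_pow]
  field_simp
  ring

/-! ## §3 `q`-uniform forms on the Brillouin zone (`|q|² ≤ Dπ²`) -/

/-- [folklore] **UNIFORM MASS BOUND**: `Σ_m Σ_κ ‖A_{mκ}‖² ≤ K_A(D, Dπ²) · N² · E(A)` for every `q ∈ [−π, π]^D ∖ {0}` and `N ≥ 1`. -/
theorem sum_normSq_le_fibre_unif (hN : 1 ≤ N) (q : Fin D → ℝ) (hq : ∀ i, |q i| ≤ π) (hq0 : q ≠ 0)
    (h : ∀ m, LAl N (ofRealVec q) m ≠ 0) {A : TorusSite D N → Fin D → ℂ} {c : ℂ}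
    (hG : GRows (fibreAl N (ofRealVec q) h) 0 A c) (hQ : QRows (fibreAl N (ofRealVec q) h) 0 A) :
    ∑ m, ∑ κ, ‖A m κ‖ ^ 2 ≤ kAOf D (D * π ^ 2) * (N : ℝ) ^ 2 * energy (fibreAl N (ofRealVec q) h) A :=
  (sum_normSq_le_fibre hN q hq hq0 h hG hQ).trans
    (mul_le_mul_of_nonneg_right
      (mul_le_mul_of_nonneg_right (kAOf_mono D (momSq_nonneg q) (CapacitanceCancellationDefect.momSq_le_of_abs_le hq)) (sq_nonneg _))
      (energy_nonneg _ A))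

/-- [folklore] **UNIFORM GAUGE-CONSTANT BOUND**: `‖c‖² ≤ K_c(D, Dπ²)/N⁴ · E(A)` for every `q ∈ [−π, π]^D ∖ {0}` and `N ≥ 1`. -/
theorem norm_c_sq_le_fibre_unif (hN : 1 ≤ N) (q : Fin D → ℝ) (hq : ∀ i, |q i| ≤ π) (hq0 : q ≠ 0)
    (h : ∀ m, LAl N (ofRealVec q) m ≠ 0) {A : TorusSite D N → Fin D → ℂ} {c : ℂ}
    (hG : GRows (fibreAl N (ofRealVec q) h) 0 A c) (hQ : QRows (fibreAl N (ofRealVec q) h) 0 A) :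
    ‖c‖ ^ 2 ≤ kcOf D (D * π ^ 2) / (N : ℝ) ^ 4 * energy (fibreAl N (ofRealVec q) h) A := by
  have hN0 : (0 : ℝ) < N := by exact_mod_cast hN
  exact (norm_c_sq_le_fibre hN q hq hq0 h hG hQ).trans
    (mul_le_mul_of_nonneg_right
      (div_le_div_of_nonneg_right (kcOf_mono D (momSq_nonneg q) (CapacitanceCancellationDefect.momSq_le_of_abs_le hq)) (by positivity))
      (energy_nonneg _ A))

end Summit.QuantumFields.BalabanUV.Beta.GAN24.FibreKernelControlAliasBound

end
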